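import Literature.Analysis.FluidPDE.CKNStep3KernelBounds
import Literature.Analysis.FluidPDE.HeatNewtonOffDiagonal
import Literature.Analysis.FluidPDE.NewtonLocalPotential
import HarnessLib

/-!
# Kernel representations for the heat flow of truncated Newtonian potentials

Analysis/FluidPDE support file (everything proved) for the discharge of the named fact
`Literature.Analysis.FluidPDE.LemarieRieusset2016.step3_velocityBound`
(`CKNMorreyRepresentation.lean`; Lemarié-Rieusset 2016, §13.9 Step 3, (13.50)–(13.52),
pp. 474–475). In the duality proof of (13.52) the pressure term `φ∇p` is eliminated by testing the
pressure equation `Δp = -∑∂ⱼ∂ₗ(uⱼuₗ)` with the backward caloric integral of a slicewise truncated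
Newtonian potential `N[h] = Γ₀ ⋆ h` (`newtonNearPotential`, `Γ₀ = newtonNear r₀ r₁`) of the test
data; the velocity then meets the heat flow of the derivatives of `N[h]`, i.e. the kernels
`∂^β e^{aΔ}Γ₀ = heatD_β a Γ₀` of the tree (`OseenHeat.lean`, `HeatNewtonIdentity.lean`), which play
the part of the kernel of `e^{νtΔ}∇∂ⱼ∂ₗΔ⁻¹` in print (p. 475). This file proves the corresponding
representation formulas, all of the shape "derivatives and heat flow on the test side equal an
integral of the data against an explicit kernel":

* `heatD1_integral_mul_comp_sub` — **`heatD1` commutes with superpositions of translates**: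
  `∂ᵥe^{aΔ}(∫ h(x) ψ(· - x) dx)(y) = ∫ h(x) (∂ᵥe^{aΔ}ψ)(y - x) dx` for `ψ ∈ L¹`, `h` continuous
  with compact support (Fubini); iterated: `heatD2_…`, `heatD3_…`;
* `newtonNearPotential_eq_integral_mul_comp_sub` — `N[h](y) = ∫ h(x) Γ₀(y - x) dx`, and the
  three representations `heatD_β a (N[h]) (y) = ∫ h(x) heatD_β a Γ₀ (y - x) dx`, `β = 1, 2, 3`;
  the same for the smoothing remainder `Λ[h] = λ ⋆ h` with `heatD1 a c λ`;
* `heatExtension_fderiv_eq_heatD1`, `heatExtension_fderiv2_eq_heatD2` — derivatives of smooth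
  compactly supported data pass through the heat flow (order three is the tree's
  `heatD3_eq_heatExtension_fderiv3`), so that `e^{aΔ}(∂^β N[h])` is represented by the kernels
  `heatD_β a Γ₀`, whose pointwise bounds are in `CKNStep3KernelBounds.lean` /
  `HeatNewtonOffDiagonal.lean`.

## References

* P. G. Lemarié-Rieusset, *The Navier–Stokes Problem in the 21st Century*, CRC Press (2016),
  §13.9 Step 3, (13.51)–(13.52), pp. 474–475. [LemarieRieusset2016]
* D. Gilbarg, N. S. Trudinger, *Elliptic PDE of second order* (2001), (2.16)–(2.17).
  [GilbargTrudinger2001]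
-/

noncomputable section

open MeasureTheory Set Function Filter Topology Metric Real
open scoped ENNReal NNReal RealInnerProductSpace Convolution

namespace Literature.Analysis.FluidPDE

open UnboundedOperators (heatKernel heatExtension)

/-! ### `heatD1` commutes with superpositions of translates -/

section General

variable {E : Type*} [NormedAddCommGroup E] [InnerProductSpace ℝ E] [FiniteDimensional ℝ E]
  [MeasurableSpace E] [BorelSpace E]

/-- A superposition of translates `y ↦ ∫ h(x) ψ(y - x) dx` of `ψ ∈ L¹` with continuous compactly
supported coefficients `h` is the convolution `h ⋆ ψ`. [folklore] -/
theorem integral_mul_comp_sub_eq_convolution (ψ h : E → ℝ) :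
    (fun y => ∫ x, h x * ψ (y - x)) = h ⋆[ContinuousLinearMap.lsmul ℝ ℝ, volume] ψ := by
  funext y; rw [convolution_lsmul]; simp only [smul_eq_mul]

/-- A superposition of translates of `ψ ∈ L¹` with continuous compactly supported coefficients is
continuous. [folklore] -/
theorem continuous_integral_mul_comp_sub_of_integrable {ψ : E → ℝ} (hψ : Integrable ψ)
    {h : E → ℝ} (hh : Continuous h) (hhc : HasCompactSupport h) :
    Continuous fun y => ∫ x, h x * ψ (y - x) := by
  rw [integral_mul_comp_sub_eq_convolution]
  exact hhc.continuous_convolution_left _ hh hψ.locallyIntegrable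

/-- A superposition of translates of `ψ ∈ L¹` with coefficients `|h| ≤ M` is bounded by `M ‖ψ‖₁`.
[folklore] -/
theorem norm_integral_mul_comp_sub_le {ψ : E → ℝ} (hψ : Integrable ψ) {h : E → ℝ} {M : ℝ}
    (hM : ∀ x, |h x| ≤ M) (y : E) : ‖∫ x, h x * ψ (y - x)‖ ≤ M * ∫ x, |ψ x| := by
  have hM0 : 0 ≤ M := (abs_nonneg _).trans (hM 0)
  have hint : Integrable (fun x => M * |ψ (y - x)|) := by
    have : Integrable (fun x => |ψ (y - x)|) :=
      ((hψ.comp_sub_left y).norm).congr (Eventually.of_forall fun x => Real.norm_eq_abs _)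
    exact this.const_mul M
  calc ‖∫ x, h x * ψ (y - x)‖ ≤ ∫ x, M * |ψ (y - x)| := by
        refine norm_integral_le_of_norm_le hint (Eventually.of_forall fun x => ?_)
        rw [norm_mul, Real.norm_eq_abs, Real.norm_eq_abs]
        exact mul_le_mul_of_nonneg_right (hM x) (abs_nonneg _)
    _ = M * ∫ x, |ψ x| := by
        rw [integral_const_mul]
        congr 1
        exact integral_sub_left_eq_self (fun x => |ψ x|) volume y

/-- A superposition of translates of `ψ ∈ L¹` with continuous compactly supported coefficients is
in `L^∞`. [folklore] -/
theorem memLp_top_integral_mul_comp_sub {ψ : E → ℝ} (hψ : Integrable ψ) {h : E → ℝ}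
    (hh : Continuous h) (hhc : HasCompactSupport h) :
    MemLp (fun y => ∫ x, h x * ψ (y - x)) ∞ volume := by
  obtain ⟨M, hM⟩ := hhc.exists_bound_of_continuous hh
  refine memLp_top_of_bound
    (continuous_integral_mul_comp_sub_of_integrable hψ hh hhc).aestronglyMeasurable
    (M * ∫ x, |ψ x|) (Eventually.of_forall fun y => ?_)
  exact norm_integral_mul_comp_sub_le hψ (fun x => (Real.norm_eq_abs _).symm.le.trans (hM x)) y

/-- **`heatD1` commutes with superpositions of translates**: for `ψ ∈ L¹`, `h` continuous with
compact support, `a > 0` and `v`,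
`∂ᵥ e^{aΔ}(∫ h(x) ψ(· - x) dx)(y) = ∫ h(x) (∂ᵥ e^{aΔ}ψ)(y - x) dx`
(`heatD1 a v` is the integral operator with the integrable kernel `∂ᵥG_a`; Fubini). [folklore] -/
theorem heatD1_integral_mul_comp_sub {ψ : E → ℝ} (hψ : Integrable ψ) {h : E → ℝ}
    (hh : Continuous h) (hhc : HasCompactSupport h) {a : ℝ} (ha : 0 < a) (v y : E) :
    heatD1 a v (fun y' => ∫ x, h x * ψ (y' - x)) y = ∫ x, h x * heatD1 a v ψ (y - x) := by
  set G' : E → ℝ := fun z => fderiv ℝ (heatKernel a) z v with hG'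
  have hG'int : Integrable G' := UnboundedOperators.integrable_fderiv_heatKernel_apply ha v
  have hψ1 : MemLp ψ 1 volume := (memLp_one_iff_integrable).2 hψ
  obtain ⟨M, hM⟩ := hhc.exists_bound_of_continuous hh
  have hM0 : 0 ≤ M := (norm_nonneg _).trans (hM 0)
  have hF := memLp_top_integral_mul_comp_sub hψ hh hhc
  rw [heatD1_eq_integral hF le_top ha v y]
  have hslice : ∀ x, heatD1 a v ψ (y - x) = ∫ y', G' y' * ψ (y - x - y') := fun x =>
    heatD1_eq_integral hψ1 le_rfl ha v (y - x)
  simp_rw [hslice]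
  -- the double integrand `G'(y') h(x) ψ(y - y' - x)` is integrable on `E × E`
  have hmeas : AEStronglyMeasurable (fun q : E × E => G' q.1 * (h q.2 * ψ (y - q.1 - q.2)))
      ((volume : Measure E).prod volume) := by
    refine (hG'int.aestronglyMeasurable.comp_fst).mul ((hh.aestronglyMeasurable.comp_snd).mul ?_)
    have hq : Measure.QuasiMeasurePreserving (fun q : E × E => y - (q.1 + q.2))
        ((volume : Measure E).prod volume) volume :=
      (quasiMeasurePreserving_sub_left volume y).comp (quasiMeasurePreserving_add volume volume)
    have := hψ.aestronglyMeasurable.comp_quasiMeasurePreserving hq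
    refine this.congr (Eventually.of_forall fun q => ?_)
    simp only [Function.comp_apply, sub_sub]
  have hint : Integrable (fun q : E × E => G' q.1 * (h q.2 * ψ (y - q.1 - q.2)))
      ((volume : Measure E).prod volume) := by
    refine (integrable_prod_iff hmeas).2 ⟨Eventually.of_forall fun y' => ?_, ?_⟩
    · -- slices: `x ↦ G'(y') h(x) ψ(y - y' - x)` is integrable
      change Integrable (fun x => G' y' * (h x * ψ (y - y' - x))) volume
      have h1 : Integrable (fun x => ψ (y - y' - x)) := hψ.comp_sub_left (y - y')
      have h2 : Integrable (fun x => h x * ψ (y - y' - x)) :=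
        h1.bdd_mul hh.aestronglyMeasurable (Eventually.of_forall hM)
      exact h2.const_mul _
    · -- the norm integrals are dominated by `|G'(y')| M ‖ψ‖₁`
      have hbound : ∀ y', ∫ x, ‖G' y' * (h x * ψ (y - y' - x))‖ ≤ ‖G' y'‖ * (M * ∫ x, |ψ x|) := by
        intro y'
        have h1 : Integrable (fun x => |ψ (y - y' - x)|) :=
          ((hψ.comp_sub_left (y - y')).norm).congr (Eventually.of_forall fun x => Real.norm_eq_abs _)
        calc ∫ x, ‖G' y' * (h x * ψ (y - y' - x))‖
            ≤ ∫ x, ‖G' y'‖ * (M * |ψ (y - y' - x)|) := by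
              refine integral_mono_of_nonneg (Eventually.of_forall fun x => norm_nonneg _)
                ((h1.const_mul M).const_mul _) (Eventually.of_forall fun x => ?_)
              simp only [norm_mul, Real.norm_eq_abs]
              gcongr
              · exact (Real.norm_eq_abs _).symm.le.trans (hM x)
          _ = ‖G' y'‖ * (M * ∫ x, |ψ x|) := by
              rw [integral_const_mul, integral_const_mul]
              congr 2
              exact integral_sub_left_eq_self (fun x => |ψ x|) volume (y - y')
      refine (hG'int.norm.mul_const (M * ∫ x, |ψ x|)).mono' hmeas.norm.integral_prod_right' ?_
      refine Eventually.of_forall fun y' => ?_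
      rw [Real.norm_of_nonneg (integral_nonneg fun x => norm_nonneg _)]
      exact hbound y'
  calc ∫ y', G' y' * ∫ x, h x * ψ (y - y' - x)
      = ∫ y', ∫ x, G' y' * (h x * ψ (y - y' - x)) := by
        congr 1; funext y'; rw [integral_const_mul]
    _ = ∫ x, ∫ y', G' y' * (h x * ψ (y - y' - x)) := integral_integral_swap hint
    _ = ∫ x, h x * ∫ y', G' y' * ψ (y - x - y') := by
        congr 1; funext x
        rw [← integral_const_mul]
        congr 1; funext y'
        rw [sub_right_comm]
        ring

/-- **`heatD2` commutes with superpositions of translates** (`heatD2 = heatD1 ∘ heatD1`).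
[folklore] -/
theorem heatD2_integral_mul_comp_sub {ψ : E → ℝ} (hψ : Integrable ψ) {h : E → ℝ}
    (hh : Continuous h) (hhc : HasCompactSupport h) {a : ℝ} (ha : 0 < a) (v w y : E) :
    heatD2 a v w (fun y' => ∫ x, h x * ψ (y' - x)) y = ∫ x, h x * heatD2 a v w ψ (y - x) := by
  have h2 : 0 < a / 2 := by positivity
  have hψ1 : MemLp ψ 1 volume := (memLp_one_iff_integrable).2 hψ
  have hF := memLp_top_integral_mul_comp_sub hψ hh hhc
  have hψ₁ : Integrable (heatD1 (a / 2) w ψ) :=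
    (memLp_one_iff_integrable).1 (memLp_heatD1 hψ1 le_rfl h2 w)
  rw [show a = a / 2 + a / 2 by ring, heatD2_eq_heatD1_heatD1 hF le_top h2 h2 v w]
  have e1 : heatD1 (a / 2) w (fun y' => ∫ x, h x * ψ (y' - x)) =
      fun y' => ∫ x, h x * heatD1 (a / 2) w ψ (y' - x) :=
    funext fun y' => heatD1_integral_mul_comp_sub hψ hh hhc h2 w y'
  rw [e1, heatD1_integral_mul_comp_sub hψ₁ hh hhc h2 v y]
  congr 1; funext x
  rw [heatD2_eq_heatD1_heatD1 hψ1 le_rfl h2 h2 v w]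

/-- **`heatD3` commutes with superpositions of translates** (`heatD3 = heatD1 ∘ heatD1 ∘ heatD1`).
[folklore] -/
theorem heatD3_integral_mul_comp_sub {ψ : E → ℝ} (hψ : Integrable ψ) {h : E → ℝ}
    (hh : Continuous h) (hhc : HasCompactSupport h) {a : ℝ} (ha : 0 < a) (u v w y : E) :
    heatD3 a u v w (fun y' => ∫ x, h x * ψ (y' - x)) y =
      ∫ x, h x * heatD3 a u v w ψ (y - x) := by
  have h3 : 0 < a / 3 := by positivity
  have hψ1 : MemLp ψ 1 volume := (memLp_one_iff_integrable).2 hψ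
  have hF := memLp_top_integral_mul_comp_sub hψ hh hhc
  have m₁ : MemLp (heatD1 (a / 3) w ψ) 1 volume := memLp_heatD1 hψ1 le_rfl h3 w
  have hψ₁ : Integrable (heatD1 (a / 3) w ψ) := (memLp_one_iff_integrable).1 m₁
  have m₂ : MemLp (heatD1 (a / 3) v (heatD1 (a / 3) w ψ)) 1 volume := memLp_heatD1 m₁ le_rfl h3 v
  have hψ₂ : Integrable (heatD1 (a / 3) v (heatD1 (a / 3) w ψ)) := (memLp_one_iff_integrable).1 m₂
  rw [show a = a / 3 + a / 3 + a / 3 by ring, heatD3_eq_heatD1_heatD1_heatD1 hF le_top h3 h3 h3]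
  have e1 : heatD1 (a / 3) w (fun y' => ∫ x, h x * ψ (y' - x)) =
      fun y' => ∫ x, h x * heatD1 (a / 3) w ψ (y' - x) :=
    funext fun y' => heatD1_integral_mul_comp_sub hψ hh hhc h3 w y'
  rw [e1]
  have e2 : heatD1 (a / 3) v (fun y' => ∫ x, h x * heatD1 (a / 3) w ψ (y' - x)) =
      fun y' => ∫ x, h x * heatD1 (a / 3) v (heatD1 (a / 3) w ψ) (y' - x) :=
    funext fun y' => heatD1_integral_mul_comp_sub hψ₁ hh hhc h3 v y'
  rw [e2, heatD1_integral_mul_comp_sub hψ₂ hh hhc h3 u y]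
  congr 1; funext x
  rw [heatD3_eq_heatD1_heatD1_heatD1 hψ1 le_rfl h3 h3 h3]

/-! ### Derivatives of smooth compactly supported data pass through the heat flow -/

/-- `e^{aΔ}(∂_c g)(y) = heatD1 a c g (y)` for `g ∈ C_c^∞` (the derivative falls on the data,
`fderiv_heatExtension_apply_eq_heatExtension_fderiv`). [folklore] -/
theorem heatExtension_fderiv_eq_heatD1 {g : E → ℝ} (hg : ContDiff ℝ ((⊤ : ℕ∞) : WithTop ℕ∞) g)
    (hgc : HasCompactSupport g) {a : ℝ} (ha : 0 < a) (c y : E) :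
    heatExtension (fun z => fderiv ℝ g z c) a y = heatD1 a c g y := by
  have m0 : MemLp g 1 (volume : Measure E) := hg.continuous.memLp_of_hasCompactSupport hgc
  obtain ⟨hg₁, hg₁c⟩ := contDiff_hasCompactSupport_fderiv_apply hg hgc c
  have m1 : MemLp (fun z => fderiv ℝ g z c) 1 (volume : Measure E) :=
    hg₁.continuous.memLp_of_hasCompactSupport hg₁c
  rw [heatD1, UnboundedOperators.fderiv_heatExtension_apply_eq_heatExtension_fderiv
    (hg.of_le (by exact_mod_cast le_top)) m0 le_rfl m1 le_rfl ha y]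

/-- `e^{aΔ}(∂ᵥ∂_c g)(y) = heatD2 a v c g (y)` for `g ∈ C_c^∞`. [folklore] -/
theorem heatExtension_fderiv2_eq_heatD2 {g : E → ℝ} (hg : ContDiff ℝ ((⊤ : ℕ∞) : WithTop ℕ∞) g)
    (hgc : HasCompactSupport g) {a : ℝ} (ha : 0 < a) (v c y : E) :
    heatExtension (fun z => fderiv ℝ (fun z' => fderiv ℝ g z' c) z v) a y = heatD2 a v c g y := by
  obtain ⟨hg₁, hg₁c⟩ := contDiff_hasCompactSupport_fderiv_apply hg hgc c
  have hfun : heatExtension (fun z => fderiv ℝ g z c) a = fun z => fderiv ℝ (heatExtension g a) z c :=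
    funext fun z => heatExtension_fderiv_eq_heatD1 hg hgc ha c z
  rw [heatExtension_fderiv_eq_heatD1 hg₁ hg₁c ha v y, heatD2, heatD1, hfun]

end General

/-! ### The truncated Newtonian potential: representations of `heatD_β a (N[h])` -/

section Newton

variable {r₀ r₁ : ℝ} {h : EuclideanSpace ℝ (Fin 3) → ℝ}

/-- **`N[h](y) = ∫ h(x) Γ₀(y - x) dx`** (the substitution `x = y - z` in
`N[h](y) = ∫ Γ₀(z) h(y - z) dz`). [folklore] -/
theorem newtonNearPotential_eq_integral_mul_comp_sub (r₀ r₁ : ℝ) (h : EuclideanSpace ℝ (Fin 3) → ℝ)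
    (y : EuclideanSpace ℝ (Fin 3)) :
    newtonNearPotential r₀ r₁ h y = ∫ x, h x * newtonNear r₀ r₁ (y - x) := by
  rw [newtonNearPotential_apply]
  have := integral_sub_left_eq_self (fun x => h x * newtonNear r₀ r₁ (y - x)) volume y
  simp only [sub_sub_cancel] at this
  rw [← this]
  congr 1; funext z; ring

/-- `N[h]` as a function: `N[h] = fun y => ∫ h(x) Γ₀(y - x) dx`. [folklore] -/
theorem newtonNearPotential_eq_integral_mul_comp_sub' (r₀ r₁ : ℝ) (h : EuclideanSpace ℝ (Fin 3) → ℝ) :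
    newtonNearPotential r₀ r₁ h = fun y => ∫ x, h x * newtonNear r₀ r₁ (y - x) :=
  funext fun y => newtonNearPotential_eq_integral_mul_comp_sub r₀ r₁ h y

/-- **`Λ[h](y) = ∫ h(x) λ(y - x) dx`** for the smoothing remainder. [folklore] -/
theorem newtonFarSmoothing_eq_integral_mul_comp_sub' (r₀ r₁ : ℝ) (h : EuclideanSpace ℝ (Fin 3) → ℝ) :
    newtonFarSmoothing r₀ r₁ h = fun y => ∫ x, h x * newtonFarLaplacian r₀ r₁ (y - x) := by
  funext y
  rw [newtonFarSmoothing_apply]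
  have := integral_sub_left_eq_self (fun x => h x * newtonFarLaplacian r₀ r₁ (y - x)) volume y
  simp only [sub_sub_cancel] at this
  rw [← this]
  congr 1; funext z; ring

/-- **`heatD1 a c (N[h]) (y) = ∫ h(x) heatD1 a c Γ₀ (y - x) dx`** for `h` continuous with compact
support, `0 ≤ r₀ < r₁`, `a > 0`: the heat flow of the gradient of the truncated potential is the
data against the kernel `∂_c e^{aΔ}Γ₀`. [folklore] -/
theorem heatD1_newtonNearPotential_eq (h₀ : 0 ≤ r₀) (h₁ : r₀ < r₁) (hh : Continuous h)
    (hhc : HasCompactSupport h) {a : ℝ} (ha : 0 < a) (c y : EuclideanSpace ℝ (Fin 3)) :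
    heatD1 a c (newtonNearPotential r₀ r₁ h) y = ∫ x, h x * heatD1 a c (newtonNear r₀ r₁) (y - x) := by
  rw [newtonNearPotential_eq_integral_mul_comp_sub']
  exact heatD1_integral_mul_comp_sub (integrable_newtonNear h₀ h₁) hh hhc ha c y

/-- **`heatD2 a v c (N[h]) (y) = ∫ h(x) heatD2 a v c Γ₀ (y - x) dx`**. [folklore] -/
theorem heatD2_newtonNearPotential_eq (h₀ : 0 ≤ r₀) (h₁ : r₀ < r₁) (hh : Continuous h)
    (hhc : HasCompactSupport h) {a : ℝ} (ha : 0 < a) (v c y : EuclideanSpace ℝ (Fin 3)) :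
    heatD2 a v c (newtonNearPotential r₀ r₁ h) y =
      ∫ x, h x * heatD2 a v c (newtonNear r₀ r₁) (y - x) := by
  rw [newtonNearPotential_eq_integral_mul_comp_sub']
  exact heatD2_integral_mul_comp_sub (integrable_newtonNear h₀ h₁) hh hhc ha v c y

/-- **`heatD3 a u v w (N[h]) (y) = ∫ h(x) heatD3 a u v w Γ₀ (y - x) dx`**: the heat flow of the
third derivatives of the truncated potential is the data against the Oseen-type kernel
`∂ᵤ∂ᵥ∂_w e^{aΔ}Γ₀` (the kernel of `e^{νtΔ}∇∂ⱼ∂ₗΔ⁻¹` of Lemarié-Rieusset 2016, p. 475, for the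
truncated kernel). [cite: LemarieRieusset2016, §13.9 Step 3 p. 475] -/
theorem heatD3_newtonNearPotential_eq (h₀ : 0 ≤ r₀) (h₁ : r₀ < r₁) (hh : Continuous h)
    (hhc : HasCompactSupport h) {a : ℝ} (ha : 0 < a) (u v w y : EuclideanSpace ℝ (Fin 3)) :
    heatD3 a u v w (newtonNearPotential r₀ r₁ h) y =
      ∫ x, h x * heatD3 a u v w (newtonNear r₀ r₁) (y - x) := by
  rw [newtonNearPotential_eq_integral_mul_comp_sub']
  exact heatD3_integral_mul_comp_sub (integrable_newtonNear h₀ h₁) hh hhc ha u v w y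

/-- **`heatD1 a c (Λ[h]) (y) = ∫ h(x) heatD1 a c λ (y - x) dx`** for the smoothing remainder
(`λ = newtonFarLaplacian r₀ r₁ ∈ L¹`). [folklore] -/
theorem heatD1_newtonFarSmoothing_eq (h₀ : 0 < r₀) (h₁ : r₀ < r₁) (hh : Continuous h)
    (hhc : HasCompactSupport h) {a : ℝ} (ha : 0 < a) (c y : EuclideanSpace ℝ (Fin 3)) :
    heatD1 a c (newtonFarSmoothing r₀ r₁ h) y =
      ∫ x, h x * heatD1 a c (newtonFarLaplacian r₀ r₁) (y - x) := by
  rw [newtonFarSmoothing_eq_integral_mul_comp_sub']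
  exact heatD1_integral_mul_comp_sub (integrable_newtonFarLaplacian h₀ h₁) hh hhc ha c y

/-! ### Heat flow of the derivatives of `N[h]`, `Λ[h]` for smooth compactly supported `h` -/

variable (hh : ContDiff ℝ ((⊤ : ℕ∞) : WithTop ℕ∞) h) (hhc : HasCompactSupport h)
include hh hhc

/-- `N[h] ∈ C_c^∞` for `h ∈ C_c^∞`. [folklore] -/
theorem contDiff_hasCompactSupport_newtonNearPotential (h₀ : 0 ≤ r₀) (h₁ : r₀ < r₁) :
    ContDiff ℝ ((⊤ : ℕ∞) : WithTop ℕ∞) (newtonNearPotential r₀ r₁ h) ∧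
      HasCompactSupport (newtonNearPotential r₀ r₁ h) :=
  ⟨contDiff_newtonNearPotential_top h₀ h₁ hh, hasCompactSupport_newtonNearPotential h₀ h₁ hhc⟩

/-- `Λ[h] ∈ C_c^∞` for `h ∈ C_c^∞`. [folklore] -/
theorem contDiff_hasCompactSupport_newtonFarSmoothing (h₀ : 0 < r₀) (h₁ : r₀ < r₁) :
    ContDiff ℝ ((⊤ : ℕ∞) : WithTop ℕ∞) (newtonFarSmoothing r₀ r₁ h) ∧
      HasCompactSupport (newtonFarSmoothing r₀ r₁ h) :=
  ⟨contDiff_infty.2 fun n => contDiff_newtonFarSmoothing h₀ h₁ n (contDiff_infty.1 hh n),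
    hasCompactSupport_newtonFarSmoothing h₀.le h₁ hhc⟩

/-- **`e^{aΔ}(∂_c N[h])(y) = ∫ h(x) heatD1 a c Γ₀ (y - x) dx`** for `h ∈ C_c^∞`, `0 < r₀ < r₁`,
`a > 0`. [folklore] -/
theorem heatExtension_fderiv_newtonNearPotential_eq (h₀ : 0 < r₀) (h₁ : r₀ < r₁) {a : ℝ}
    (ha : 0 < a) (c y : EuclideanSpace ℝ (Fin 3)) :
    heatExtension (fun z => fderiv ℝ (newtonNearPotential r₀ r₁ h) z c) a y =
      ∫ x, h x * heatD1 a c (newtonNear r₀ r₁) (y - x) := by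
  obtain ⟨hN, hNc⟩ := contDiff_hasCompactSupport_newtonNearPotential hh hhc h₀.le h₁
  rw [heatExtension_fderiv_eq_heatD1 hN hNc ha c y,
    heatD1_newtonNearPotential_eq h₀.le h₁ hh.continuous hhc ha c y]

/-- **`e^{aΔ}(∂ᵥ∂_c N[h])(y) = ∫ h(x) heatD2 a v c Γ₀ (y - x) dx`** for `h ∈ C_c^∞`. [folklore] -/
theorem heatExtension_fderiv2_newtonNearPotential_eq (h₀ : 0 < r₀) (h₁ : r₀ < r₁) {a : ℝ}
    (ha : 0 < a) (v c y : EuclideanSpace ℝ (Fin 3)) :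
    heatExtension (fun z => fderiv ℝ (fun z' => fderiv ℝ (newtonNearPotential r₀ r₁ h) z' c) z v) a y =
      ∫ x, h x * heatD2 a v c (newtonNear r₀ r₁) (y - x) := by
  obtain ⟨hN, hNc⟩ := contDiff_hasCompactSupport_newtonNearPotential hh hhc h₀.le h₁
  rw [heatExtension_fderiv2_eq_heatD2 hN hNc ha v c y,
    heatD2_newtonNearPotential_eq h₀.le h₁ hh.continuous hhc ha v c y]

/-- **`e^{aΔ}(∂ᵤ∂ᵥ∂_w N[h])(y) = ∫ h(x) heatD3 a u v w Γ₀ (y - x) dx`** for `h ∈ C_c^∞`: the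
representation of the main pressure term through the Oseen-type kernel (Lemarié-Rieusset 2016,
(13.51)–(13.52), the term `∇∂ⱼ∂ₗG * (φuⱼuₗ)` under the heat flow). [cite: LemarieRieusset2016, §13.9 Step 3 (13.51)–(13.52) p. 475] -/
theorem heatExtension_fderiv3_newtonNearPotential_eq (h₀ : 0 < r₀) (h₁ : r₀ < r₁) {a : ℝ}
    (ha : 0 < a) (u v w y : EuclideanSpace ℝ (Fin 3)) :
    heatExtension (fun z => fderiv ℝ (fun z' => fderiv ℝ
      (fun z'' => fderiv ℝ (newtonNearPotential r₀ r₁ h) z'' w) z' v) z u) a y =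
      ∫ x, h x * heatD3 a u v w (newtonNear r₀ r₁) (y - x) := by
  obtain ⟨hN, hNc⟩ := contDiff_hasCompactSupport_newtonNearPotential hh hhc h₀.le h₁
  rw [← congrFun (heatD3_eq_heatExtension_fderiv3 hN hNc ha u v w) y,
    heatD3_newtonNearPotential_eq h₀.le h₁ hh.continuous hhc ha u v w y]

/-- **`e^{aΔ}(∂_c Λ[h])(y) = ∫ h(x) heatD1 a c λ (y - x) dx`** for `h ∈ C_c^∞` (and
`∂_cΛ[h] = Λ[∂_c h]`, `fderiv_newtonFarSmoothing_apply`). [folklore] -/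
theorem heatExtension_fderiv_newtonFarSmoothing_eq (h₀ : 0 < r₀) (h₁ : r₀ < r₁) {a : ℝ}
    (ha : 0 < a) (c y : EuclideanSpace ℝ (Fin 3)) :
    heatExtension (fun z => fderiv ℝ (newtonFarSmoothing r₀ r₁ h) z c) a y =
      ∫ x, h x * heatD1 a c (newtonFarLaplacian r₀ r₁) (y - x) := by
  obtain ⟨hL, hLc⟩ := contDiff_hasCompactSupport_newtonFarSmoothing hh hhc h₀ h₁
  rw [heatExtension_fderiv_eq_heatD1 hL hLc ha c y,
    heatD1_newtonFarSmoothing_eq h₀ h₁ hh.continuous hhc ha c y]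

end Newton

end Literature.Analysis.FluidPDE
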